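import Literature.NumberTheory.IwasawaTheory.ClassicalMuVanishesQuadraticAscentNarrow
import Literature.NumberTheory.IwasawaTheory.ClassicalMuVanishesQuadraticAscentSqrtOdd
import Literature.NumberTheory.NumberFields.NarrowClassNumberRingEquiv
import HarnessLib

/-!
# Kida-lite over `ℚ`: `μ₂ = 0` ascends `K(√m)/K` (`[K : ℚ]` odd, `K(√m)` totally complex) whenever `μ₂(K) = 0` and the NARROW defect
# `ord₂ h⁺(K_n) − ord₂ h(K_n)` of the cyclotomic `ℤ₂`-tower of `K` is bounded (proved; no definition, no named fact)

`Proofs`-style file (theorems only) in topic `NumberTheory/IwasawaTheory` (namespace `Literature.NumberTheory.IwasawaTheory`), written by the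
prover seat `cruxlead-stmt-BirchSwinnertonDyer-19573-w2` GEN 8 (cell `bsd-2adic`; `--supports` stmt-BirchSwinnertonDyer-19573; closes nothing).
Module (E⁺) of the seat's «Kida-lite at `ℓ = 2`»: the `ℚ`-specialisation of `ClassicalMuVanishesQuadraticAscentNarrow` (module (T⁺)), twin of
GEN 7's `ClassicalMuVanishesQuadraticAscentSqrt` / `…SqrtOdd` with their hypothesis «`K` has at most ONE real embedding» (which forced the
narrow defect of `K·ℚ_n` to vanish through the units of `ℚ_n`) replaced by «the narrow defect of the layers is bounded» — so that `K` may now be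
TOTALLY REAL (e.g. the cubic point field `ℚ(P)` of an elliptic curve with `Δ > 0`).

* §1 `ncard_ramified_fieldRange_sup_layer_le_of_sq_eq` — the ramified-prime count of GEN 7's (E-b), extracted as a lemma for ANY embedding
  `j' : K' → ℚ̄`: at most `T(K, m) = ∑_{ℓ ∣ N(4m)} [K:ℚ]·ℓ²` primes of `A_n = j(K)·ℚ_n` ramify in `B_n = j'(K')·ℚ_n` (`K' = K(x)`, `x² = m ∈ 𝓞_K ∖ 0`).
* §2 `classicalMuVanishes_restrict_rat_of_sq_eq_of_narrowDefect_le` — `μ₂(κ|_K) = 0` ∧ «`ord₂ h⁺(A_n) ≤ ord₂ h(A_n) + D` for all `n`» ⟹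
  `μ₂(κ|_{K'}) = 0` (`[K' : K] = 2`, `K'` totally complex, `κ ∘ res` onto for both; `j'` arbitrary).
* §3 **`classicalMu_of_sq_eq_of_odd_finrank_of_narrowDefect_le`** — INTRINSIC form: `K ⊆ K'` number fields, `[K : ℚ]` odd, `K'` totally complex,
  `K' = K(x)`, `x² = m ∈ 𝓞_K ∖ 0`; if every cyclotomic `ℤ₂`-extension `κP` of `K` has `μ = 0` AND `ord₂ h⁺(K_n) ≤ ord₂ h(K_n) + D` along its
  layers `K_n = (κP).layer n`, then every cyclotomic `ℤ₂`-extension of `K'` has `μ = 0`.  (The two hypotheses together are the numerical form of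
  «the NARROW Iwasawa module of `K_∞/K` has `μ = 0`»; transport of `h⁺` along `K_n ≅ j(K)·ℚ_n` by `narrowClassNumber_eq_of_ringEquiv`.)

HONEST SCOPE.  The bounded-defect hypothesis is a `∀ n` statement about the totally real (or any) tower `K·ℚ_n`; the tree can discharge it
today only where `h⁺(K·ℚ_n)` is controlled outright (e.g. `D = 0` from GEN 7's unit-signature route when `K` has ≤ 1 real place).  For a totally
real `S₃`-cubic `K` it is Greenberg-conjecture territory (Kida 1982 reduces `μ₂(K(√−1)) = 0` to exactly this); nothing is asserted about it.

References: [Kida1982JFields] Y. Kida, *Cyclotomic ℤ₂-extensions of J-fields*, J. Number Theory 14 (1982) 340–352 (shape; not held);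
[Iwasawa1973MuInvariants] Thm. 2/3, §4; [Washington1997] §13.1, §13.3 Prop. 13.23; [NeukirchANT1999] Ch. III (2.6); [FrohlichTaylor1990] Ch. V §1 (1.12).
-/

set_option autoImplicit false

noncomputable section

open scoped NumberField Classical
open NumberField Field IntermediateField IsDedekindDomain

namespace Literature.NumberTheory.IwasawaTheory

open Literature.NumberTheory.EllipticCurves Literature.NumberTheory.EllipticCurves.ZpExtension
  Literature.NumberTheory.GaloisRepresentations Literature.NumberTheory.NumberFields

variable (κ : ZpExtension ℚ 2)

/-- An integral element of `ℚ̄` lying in a subfield `L` is integral in `L`. [folklore] -/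
private theorem isIntegral_mk_of_isIntegral' {L : IntermediateField ℚ (AlgebraicClosure ℚ)} {y : AlgebraicClosure ℚ} (hy : y ∈ L)
    (hint : IsIntegral ℤ y) : IsIntegral ℤ (⟨y, hy⟩ : ↥L) :=
  (isIntegral_algHom_iff (IsScalarTower.toAlgHom ℤ ↥L (AlgebraicClosure ℚ)) Subtype.val_injective).mp hint

/-! ## §1 The ramified primes of the layers `j(K)·ℚ_n ⊆ j'(K')·ℚ_n` for `K' = K(√m)` -/

set_option maxHeartbeats 400000 in
/-- **At most `∑_{ℓ ∣ N(4m)} [K:ℚ]·ℓ²` primes of `A_n = j(K)·ℚ_n` ramify in `B_n = j'(K')·ℚ_n`** (`κ` the cyclotomic `ℤ₂`-extension of `ℚ`;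
`K ⊆ K'` number fields, `[K' : K] = 2`, `K' = K(x)`, `x ∈ 𝓞_{K'}`, `x² = m ∈ 𝓞_K ∖ 0`; `j' : K' → ℚ̄` ANY `ℚ`-embedding, `j = j'|_K`): a ramified
prime contains `4m` (tree `SqrtGeneratorUnramified` / `QuadraticRamifiedPrimesBound`), hence lies over a prime factor `ℓ` of `N₀ = N(4m·𝓞_K)`, and
`A_n` has at most `[A_n : ℚ_n]·ℓ² = [K:ℚ]·ℓ²` primes over `ℓ` (`ℚ_n` has at most `ℓ²`). GEN 7's count (E-b), extracted verbatim as a lemma.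
[cite: NeukirchANT1999, Ch. III (2.6)] [cite: Washington1997, Thm. 2.13 and §13.1] -/
theorem ncard_ramified_fieldRange_sup_layer_le_of_sq_eq (hκ : κ.IsCyclotomic)
    (K K' : Type) [Field K] [NumberField K] [Field K'] [NumberField K'] [Algebra K K'] (hdeg : Module.finrank K K' = 2)
    {x : 𝓞 K'} {m : 𝓞 K} (hm : m ≠ 0) (hx : x ^ 2 = algebraMap (𝓞 K) (𝓞 K') m) (hgen : Algebra.adjoin K {(x : K')} = ⊤)
    (hK : Function.Surjective (κ.toContinuousMonoidHom.comp (absGaloisRestrict ℚ K)))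
    (hK' : Function.Surjective (κ.toContinuousMonoidHom.comp (absGaloisRestrict ℚ K')))
    (j' : K' →ₐ[ℚ] AlgebraicClosure ℚ) (n : ℕ) :
    letI : Algebra ↥((j'.comp (IsScalarTower.toAlgHom ℚ K K')).fieldRange ⊔ κ.layer n) ↥(j'.fieldRange ⊔ κ.layer n) :=
      (IntermediateField.inclusion (fieldRange_comp_sup_layer_le κ K K' j' n)).toRingHom.toAlgebra
    {v : HeightOneSpectrum (𝓞 ↥((j'.comp (IsScalarTower.toAlgHom ℚ K K')).fieldRange ⊔ κ.layer n)) |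
        v.asIdeal.ramificationIdxIn (𝓞 ↥(j'.fieldRange ⊔ κ.layer n)) ≠ 1}.ncard ≤
      ∑ ℓ ∈ ((Ideal.absNorm (Ideal.span {(4 * m : 𝓞 K)}) : ℤ)).natAbs.primeFactors, Module.finrank ℚ K * ℓ ^ 2 := by
  haveI : Fact (Nat.Prime 2) := ⟨Nat.prime_two⟩
  haveI : FiniteDimensional K K' := Module.Finite.of_restrictScalars_finite ℚ K K'
  set j : K →ₐ[ℚ] AlgebraicClosure ℚ := j'.comp (IsScalarTower.toAlgHom ℚ K K') with hj
  -- the integer `N₀ = N(4m)` whose prime factors control the ramified primes of every layer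
  set N₀ : ℕ := Ideal.absNorm (Ideal.span {(4 * m : 𝓞 K)}) with hN₀
  have h4m0 : (4 * m : 𝓞 K) ≠ 0 := mul_ne_zero (by norm_num) hm
  have hN₀0 : (N₀ : ℤ) ≠ 0 := by
    rw [hN₀]
    exact_mod_cast (Ideal.absNorm_eq_zero_iff.not.mpr (mt Ideal.span_singleton_eq_bot.mp h4m0))
  have hdvdK : (4 * m : 𝓞 K) ∣ ((N₀ : ℤ) : 𝓞 K) := by
    rw [← Ideal.mem_span_singleton]
    have h := Ideal.absNorm_mem (Ideal.span {(4 * m : 𝓞 K)})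
    rw [← hN₀] at h
    exact_mod_cast h
  -- the layer `A = j(K)·ℚ_n ⊆ B = j'(K')·ℚ_n`
  set L : IntermediateField ℚ (AlgebraicClosure ℚ) := κ.layer n with hL
  set A : IntermediateField ℚ (AlgebraicClosure ℚ) := j.fieldRange ⊔ L with hA
  set B : IntermediateField ℚ (AlgebraicClosure ℚ) := j'.fieldRange ⊔ L with hB
  have hAB : A ≤ B := fieldRange_comp_sup_layer_le κ K K' j' n
  haveI : NumberField ↥A := numberField_fieldRange_sup_layer κ K j n
  haveI : NumberField ↥B := numberField_fieldRange_sup_layer κ K' j' n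
  letI : Algebra ↥A ↥B := (IntermediateField.inclusion hAB).toRingHom.toAlgebra
  haveI : IsScalarTower ℚ ↥A ↥B := IsScalarTower.of_algebraMap_eq fun _ ↦ rfl
  haveI : Module.Free ↥A ↥B := Module.Free.of_divisionRing ↥A ↥B
  haveI : FiniteDimensional ↥A ↥B := Module.Finite.of_restrictScalars_finite ℚ ↥A ↥B
  haveI : FiniteDimensional ℚ ↥L := κ.finiteDimensional_layer_holds n
  haveI : NumberField ↥L := NumberField.of_module_finite ℚ _
  -- degrees
  have hdA : Module.finrank ℚ ↥A = Module.finrank ℚ K * 2 ^ n := finrank_fieldRange_sup_layer κ K hK j n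
  have hdB : Module.finrank ℚ ↥B = Module.finrank ℚ K' * 2 ^ n := finrank_fieldRange_sup_layer κ K' hK' j' n
  have hdegAB : Module.finrank ↥A ↥B = 2 := by
    have htower := Module.finrank_mul_finrank ℚ ↥A ↥B
    have hKK' := Module.finrank_mul_finrank ℚ K K'
    have h1 : Module.finrank ℚ ↥A * Module.finrank ↥A ↥B = Module.finrank ℚ ↥A * 2 := by
      rw [htower, hdB, hdA, ← hKK', hdeg]; ring
    exact Nat.eq_of_mul_eq_mul_left Module.finrank_pos h1
  haveI : Algebra.IsQuadraticExtension ↥A ↥B := ⟨hdegAB⟩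
  haveI : IsGalois ↥A ↥B := inferInstance
  -- the generator in the layer: `x_B² = m_A`, `B = A(x_B)`
  have hjA : j.fieldRange ≤ A := le_sup_left
  have hj'B : j'.fieldRange ≤ B := le_sup_left
  have hLA : L ≤ A := le_sup_right
  have hmA : (j ((m : 𝓞 K) : K)) ∈ A := hjA ⟨(m : K), rfl⟩
  have hxB : (j' ((x : 𝓞 K') : K')) ∈ B := hj'B ⟨(x : K'), rfl⟩
  let mA : 𝓞 ↥A := ⟨⟨j ((m : 𝓞 K) : K), hmA⟩, isIntegral_mk_of_isIntegral' hmA (map_isIntegral_int j m.isIntegral_coe)⟩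
  let xB : 𝓞 ↥B := ⟨⟨j' ((x : 𝓞 K') : K'), hxB⟩, isIntegral_mk_of_isIntegral' hxB (map_isIntegral_int j' x.isIntegral_coe)⟩
  have hjm : j ((m : 𝓞 K) : K) = j' (algebraMap K K' ((m : 𝓞 K) : K)) := rfl
  have hx' : ((x : 𝓞 K') : K') ^ 2 = algebraMap K K' ((m : 𝓞 K) : K) := by
    have h := congrArg (fun z : 𝓞 K' ↦ (z : K')) hx
    have e1 : (((x ^ 2 : 𝓞 K') : 𝓞 K') : K') = ((x : 𝓞 K') : K') ^ 2 := by push_cast; rfl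
    have e2 : (((algebraMap (𝓞 K) (𝓞 K') m : 𝓞 K') : 𝓞 K') : K') = algebraMap K K' ((m : 𝓞 K) : K) := rfl
    rw [← e1, ← e2]
    exact h
  have hxB2 : xB ^ 2 = algebraMap (𝓞 ↥A) (𝓞 ↥B) mA := by
    apply RingOfIntegers.ext
    apply Subtype.ext
    change (j' ((x : 𝓞 K') : K')) ^ 2 = j ((m : 𝓞 K) : K)
    rw [← map_pow, hx', hjm]
  -- `B = A(x_B)`
  have hgenB : Algebra.adjoin ↥A {((xB : 𝓞 ↥B) : ↥B)} = ⊤ := by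
    set Tad : Subalgebra ↥A ↥B := Algebra.adjoin ↥A {((xB : 𝓞 ↥B) : ↥B)} with hTad
    -- the elements of `ℚ̄` lying in `B` whose class is in `Tad`
    let S : Subalgebra ℚ (AlgebraicClosure ℚ) :=
      { carrier := {y | ∃ hy : y ∈ B, (⟨y, hy⟩ : ↥B) ∈ Tad}
        mul_mem' := by
          rintro a b ⟨ha, ha'⟩ ⟨hb, hb'⟩
          exact ⟨mul_mem ha hb, by
            have e : (⟨a * b, mul_mem ha hb⟩ : ↥B) = ⟨a, ha⟩ * ⟨b, hb⟩ := rfl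
            rw [e]; exact Tad.mul_mem ha' hb'⟩
        one_mem' := ⟨one_mem _, by
          have e : (⟨1, one_mem _⟩ : ↥B) = 1 := rfl
          rw [e]; exact Tad.one_mem⟩
        add_mem' := by
          rintro a b ⟨ha, ha'⟩ ⟨hb, hb'⟩
          exact ⟨add_mem ha hb, by
            have e : (⟨a + b, add_mem ha hb⟩ : ↥B) = ⟨a, ha⟩ + ⟨b, hb⟩ := rfl
            rw [e]; exact Tad.add_mem ha' hb'⟩
        zero_mem' := ⟨zero_mem _, by
          have e : (⟨0, zero_mem _⟩ : ↥B) = 0 := rfl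
          rw [e]; exact Tad.zero_mem⟩
        algebraMap_mem' := fun r ↦ ⟨IntermediateField.algebraMap_mem B r, Tad.algebraMap_mem (algebraMap ℚ ↥A r)⟩ }
    -- `A ⊆ S`
    have hAS : ∀ y (hy : y ∈ A), y ∈ S := fun y hy ↦ ⟨hAB hy, by
      have e : (⟨y, hAB hy⟩ : ↥B) = algebraMap ↥A ↥B ⟨y, hy⟩ := rfl
      rw [e]; exact Tad.algebraMap_mem _⟩
    -- `j'(K') ⊆ S`: every element of `K'` is a polynomial in `x` over `K`
    have hK'S : j'.fieldRange.toSubalgebra ≤ S := by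
      rintro _ ⟨y, rfl⟩
      have hy : (y : K') ∈ Algebra.adjoin K {((x : 𝓞 K') : K')} := by rw [hgen]; exact Algebra.mem_top
      induction hy using Algebra.adjoin_induction with
      | mem z hz =>
        rw [Set.mem_singleton_iff] at hz
        subst hz
        exact ⟨hxB, Algebra.subset_adjoin (Set.mem_singleton _)⟩
      | algebraMap r =>
        have : j' (algebraMap K K' r) = j r := rfl
        rw [AlgHom.toRingHom_eq_coe, RingHom.coe_coe, this]
        exact hAS _ (hjA ⟨r, rfl⟩)
      | add a b _ _ ha hb =>
        rw [AlgHom.toRingHom_eq_coe, RingHom.coe_coe, map_add]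
        exact S.add_mem ha hb
      | mul a b _ _ ha hb =>
        rw [AlgHom.toRingHom_eq_coe, RingHom.coe_coe, map_mul]
        exact S.mul_mem ha hb
    have hLS : L.toSubalgebra ≤ S := fun y hy ↦ hAS y (hLA hy)
    have hBS : B.toSubalgebra ≤ S := by
      haveI : Algebra.IsAlgebraic ℚ ↥L := Algebra.IsAlgebraic.of_finite ℚ ↥L
      rw [hB, IntermediateField.sup_toSubalgebra_of_isAlgebraic_right]
      exact sup_le hK'S hLS
    rw [eq_top_iff]
    rintro ⟨y, hy⟩ -
    obtain ⟨hy', h⟩ := hBS hy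
    exact h
  -- count: ramified primes contain `4 m_A`, which divides `N₀`
  have hmA0 : mA ≠ 0 := by
    intro h0
    apply hm
    have h1 : ((mA : 𝓞 ↥A) : ↥A) = 0 := by rw [h0]; rfl
    have h2 : j ((m : 𝓞 K) : K) = 0 := by
      have := congrArg Subtype.val h1
      rwa [ZeroMemClass.coe_zero] at this
    rw [map_eq_zero_iff j j.injective] at h2
    exact RingOfIntegers.ext (by simpa using h2)
  let ψ : 𝓞 K →+* 𝓞 ↥A :=
    { toFun := fun k ↦ ⟨⟨j ((k : 𝓞 K) : K), hjA ⟨(k : K), rfl⟩⟩,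
        isIntegral_mk_of_isIntegral' _ (map_isIntegral_int j k.isIntegral_coe)⟩
      map_one' := by apply RingOfIntegers.ext; apply Subtype.ext; simp
      map_mul' := fun a b ↦ by apply RingOfIntegers.ext; apply Subtype.ext; simp
      map_zero' := by apply RingOfIntegers.ext; apply Subtype.ext; simp
      map_add' := fun a b ↦ by apply RingOfIntegers.ext; apply Subtype.ext; simp }
  have hψm : ψ m = mA := rfl
  have hdvdA : (4 * mA : 𝓞 ↥A) ∣ (((N₀ : ℤ) : 𝓞 ↥A)) := by
    have h := map_dvd ψ hdvdK
    rw [map_mul, hψm, map_intCast] at h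
    have e4 : ψ 4 = 4 := by rw [show (4 : 𝓞 K) = ((4 : ℤ) : 𝓞 K) by norm_cast, map_intCast]; norm_cast
    rwa [e4] at h
  have hram1 := ncard_ramified_le_ncard_mem hxB2 hgenB hmA0
  have hram2 := ncard_setOf_mem_le_sum_primesOver (F := ↥A) hN₀0 hdvdA
  -- primes of `A` over `ℓ`: at most `[K : ℚ]·ℓ²`
  letI : Algebra ↥L ↥A := (IntermediateField.inclusion hLA).toRingHom.toAlgebra
  haveI : IsScalarTower ℚ ↥L ↥A := IsScalarTower.of_algebraMap_eq fun _ ↦ rfl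
  haveI : Module.Free ↥L ↥A := Module.Free.of_divisionRing ↥L ↥A
  have hdegLA : Module.finrank ↥L ↥A = Module.finrank ℚ K := by
    have htower := Module.finrank_mul_finrank ℚ ↥L ↥A
    have hLd : Module.finrank ℚ ↥L = 2 ^ n := κ.finrank_layer_holds n
    rw [hdA, hLd] at htower
    have h2n : 0 < 2 ^ n := pow_pos two_pos n
    rw [mul_comm] at htower
    exact Nat.eq_of_mul_eq_mul_right h2n (by rw [htower, mul_comm])
  have hfib : ∀ ℓ ∈ (N₀ : ℤ).natAbs.primeFactors,
      ((Ideal.span {(ℓ : ℤ)}).primesOver (𝓞 ↥A)).ncard ≤ Module.finrank ℚ K * ℓ ^ 2 := fun ℓ hℓ ↦ by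
    have hℓp : ℓ.Prime := Nat.prime_of_mem_primeFactors hℓ
    refine (ncard_primesOver_le_finrank_mul ↥L ↥A hℓp).trans ?_
    rw [hdegLA]
    exact Nat.mul_le_mul_left _ (ncard_primesOver_layer_two_le_sq hκ n hℓp)
  calc {v : HeightOneSpectrum (𝓞 ↥A) | v.asIdeal.ramificationIdxIn (𝓞 ↥B) ≠ 1}.ncard
      ≤ {v : HeightOneSpectrum (𝓞 ↥A) | 4 * mA ∈ v.asIdeal}.ncard := hram1
    _ ≤ ∑ ℓ ∈ (N₀ : ℤ).natAbs.primeFactors, ((Ideal.span {(ℓ : ℤ)}).primesOver (𝓞 ↥A)).ncard := hram2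
    _ ≤ _ := Finset.sum_le_sum hfib

/-! ## §2 The ascent over `ℚ` under a bounded narrow defect (embedding form) -/

/-- **Iwasawa's `μ₂ = 0` ascends `K(√m)/K` over `ℚ` under a bounded NARROW defect** (`κ` the cyclotomic `ℤ₂`-extension of `ℚ`; `K ⊆ K'`
number fields, `[K' : K] = 2`, `K' = K(x)`, `x ∈ 𝓞_{K'}`, `x² = m ∈ 𝓞_K ∖ 0`, `K'` totally complex, `κ ∘ res` onto for `K` and `K'`; `j' : K' → ℚ̄`
any embedding, `j = j'|_K`): if `ord₂ h⁺(A_n) ≤ ord₂ h(A_n) + D` for every layer `A_n = j(K)·ℚ_n`, then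
`ClassicalMuVanishes (κ|_K) ⟹ ClassicalMuVanishes (κ|_{K'})` — module (T⁺) with its ramification hypothesis discharged by §1.  GEN 7's
`classicalMuVanishes_restrict_rat_of_sq_eq` is the case `D = 0` forced by «`K` has at most one real embedding».
[cite: Iwasawa1973MuInvariants, Thm. 2 and Thm. 3, §4] [cite: Washington1997, §13.1 and §13.3 Prop. 13.23] [cite: NeukirchANT1999, Ch. III (2.6)] -/
theorem classicalMuVanishes_restrict_rat_of_sq_eq_of_narrowDefect_le (hκ : κ.IsCyclotomic)
    (K K' : Type) [Field K] [NumberField K] [Field K'] [NumberField K'] [Algebra K K'] [IsTotallyComplex K']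
    (hdeg : Module.finrank K K' = 2)
    {x : 𝓞 K'} {m : 𝓞 K} (hm : m ≠ 0) (hx : x ^ 2 = algebraMap (𝓞 K) (𝓞 K') m) (hgen : Algebra.adjoin K {(x : K')} = ⊤)
    (hK : Function.Surjective (κ.toContinuousMonoidHom.comp (absGaloisRestrict ℚ K)))
    (hK' : Function.Surjective (κ.toContinuousMonoidHom.comp (absGaloisRestrict ℚ K')))
    (j' : K' →ₐ[ℚ] AlgebraicClosure ℚ) (D : ℕ)
    (hδ : ∀ n : ℕ,
      haveI : NumberField ↥((j'.comp (IsScalarTower.toAlgHom ℚ K K')).fieldRange ⊔ κ.layer n) :=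
        numberField_fieldRange_sup_layer κ K (j'.comp (IsScalarTower.toAlgHom ℚ K K')) n
      padicValNat 2 (narrowClassNumber ↥((j'.comp (IsScalarTower.toAlgHom ℚ K K')).fieldRange ⊔ κ.layer n)) ≤
        padicValNat 2 (classNumber ↥((j'.comp (IsScalarTower.toAlgHom ℚ K K')).fieldRange ⊔ κ.layer n)) + D)
    (hμ : ClassicalMuVanishes (κ.restrict K hK)) :
    ClassicalMuVanishes (κ.restrict K' hK') :=
  classicalMuVanishes_restrict_of_quadratic_of_narrowDefect_le κ K K' hdeg hK hK' j'
    (∑ ℓ ∈ ((Ideal.absNorm (Ideal.span {(4 * m : 𝓞 K)}) : ℤ)).natAbs.primeFactors, Module.finrank ℚ K * ℓ ^ 2) D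
    (fun n ↦ ncard_ramified_fieldRange_sup_layer_le_of_sq_eq κ hκ K K' hdeg hm hx hgen hK hK' j' n) hδ hμ

/-! ## §3 The intrinsic form: hypotheses on the cyclotomic `ℤ₂`-tower of `K` itself -/

/-- **Kida-lite over `ℚ`, intrinsic form.** `K ⊆ K'` number fields with `[K : ℚ]` odd, `K'` totally complex, `K' = K(x)` with `x ∈ 𝓞_{K'}`,
`x² = m ∈ 𝓞_K`, `m ≠ 0`.  Suppose that for every cyclotomic `ℤ₂`-extension `κP` of `K` (a) `ClassicalMuVanishes κP` (`μ₂(K) = 0` in growth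
form) and (b) `ord₂ h⁺(K_n) ≤ ord₂ h(K_n) + D` for every layer `K_n = (κP).layer n` (bounded narrow defect).  Then every cyclotomic
`ℤ₂`-extension of `K'` has `μ = 0`.  ((a) ∧ (b) is the numerical form of «`μ = 0` for the NARROW unramified Iwasawa module of `K_∞/K`»; for
`K` totally real (b) says `#(U⁺/U²)(K_n) ∣ 2^D` for all `n`.)  Proof: `[K' : K] = 2` and both `κ ∘ res` onto (GEN 7's
`finrank_eq_two_of_sq_eq_of_isTotallyComplex`, `surjective_comp_absGaloisRestrict_of_sq_eq_of_isTotallyComplex`, `[K:ℚ]` odd); the layers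
`(κ|_K)_n ≅ j(K)·ℚ_n` as rings (`nonempty_ringEquiv_layer_restrict_fieldRange_sup_layer`), along which `h⁺` and `h` transport
(`narrowClassNumber_eq_of_ringEquiv`, `classNumber_eq_of_ringEquiv`); §2; cyclotomic invariance of `μ = 0`.
[cite: Kida1982JFields, main theorem (μ-part; shape only)] [cite: Iwasawa1973MuInvariants, Thm. 2 and Thm. 3, §4] [cite: Washington1997, §13.3 Prop. 13.23] -/
theorem classicalMu_of_sq_eq_of_odd_finrank_of_narrowDefect_le
    (K K' : Type) [Field K] [NumberField K] [Field K'] [NumberField K'] [Algebra K K'] [IsTotallyComplex K']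
    (hodd : Odd (Module.finrank ℚ K))
    {x : 𝓞 K'} {m : 𝓞 K} (hm : m ≠ 0) (hx : x ^ 2 = algebraMap (𝓞 K) (𝓞 K') m) (hgen : Algebra.adjoin K {(x : K')} = ⊤)
    (hμ : ∀ κP : ZpExtension K 2, κP.IsCyclotomic → ClassicalMuVanishes κP) (D : ℕ)
    (hδ : ∀ κP : ZpExtension K 2, κP.IsCyclotomic → ∀ n : ℕ,
      haveI : FiniteDimensional K ↥(κP.layer n) := κP.finiteDimensional_layer_holds n
      haveI : NumberField ↥(κP.layer n) := NumberField.of_module_finite K _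
      padicValNat 2 (narrowClassNumber ↥(κP.layer n)) ≤ padicValNat 2 (classNumber ↥(κP.layer n)) + D) :
    ∀ κF : ZpExtension K' 2, κF.IsCyclotomic → ClassicalMuVanishes κF := by
  intro κF hκF
  haveI : Fact (Nat.Prime 2) := ⟨Nat.prime_two⟩
  obtain ⟨κ, hκ⟩ := ZpExtension.exists_isCyclotomic_holds ℚ 2 (GaloisRep.cyclotomicCharacter_range_infinite ℚ 2)
  have hx' : ((x : 𝓞 K') : K') ^ 2 = algebraMap K K' ((m : 𝓞 K) : K) := by
    have h := congrArg (fun z : 𝓞 K' ↦ (z : K')) hx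
    have e1 : (((x ^ 2 : 𝓞 K') : 𝓞 K') : K') = ((x : 𝓞 K') : K') ^ 2 := by push_cast; rfl
    have e2 : (((algebraMap (𝓞 K) (𝓞 K') m : 𝓞 K') : 𝓞 K') : K') = algebraMap K K' ((m : 𝓞 K) : K) := rfl
    rw [← e1, ← e2]
    exact h
  have hK : Function.Surjective (κ.toContinuousMonoidHom.comp (absGaloisRestrict ℚ K)) :=
    surjective_comp_absGaloisRestrict_of_not_dvd_finrank κ K (by have := Nat.odd_iff.mp hodd; omega)
  have hK' : Function.Surjective (κ.toContinuousMonoidHom.comp (absGaloisRestrict ℚ K')) :=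
    surjective_comp_absGaloisRestrict_of_sq_eq_of_isTotallyComplex κ hκ K K' hodd hx' hgen
  have hdeg : Module.finrank K K' = 2 := finrank_eq_two_of_sq_eq_of_isTotallyComplex K K' hodd hx' hgen
  have hcycK : (κ.restrict K hK).IsCyclotomic := isCyclotomic_restrict κ hκ K hK
  have h1 : ClassicalMuVanishes (κ.restrict K hK) := hμ _ hcycK
  let j' : K' →ₐ[ℚ] AlgebraicClosure ℚ := absEmbedding ℚ K'
  have h2 : ClassicalMuVanishes (κ.restrict K' hK') := by
    refine classicalMuVanishes_restrict_rat_of_sq_eq_of_narrowDefect_le κ hκ K K' hdeg hm hx hgen hK hK' j' D (fun n ↦ ?_) h1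
    -- transport of `h⁺` and `h` along `(κ|_K)_n ≅ j(K)·ℚ_n`, `j = j'|_K`
    haveI instA : NumberField ↥((j'.comp (IsScalarTower.toAlgHom ℚ K K')).fieldRange ⊔ κ.layer n) :=
      numberField_fieldRange_sup_layer κ K (j'.comp (IsScalarTower.toAlgHom ℚ K K')) n
    haveI : FiniteDimensional K ↥((κ.restrict K hK).layer n) := (κ.restrict K hK).finiteDimensional_layer_holds n
    haveI instL : NumberField ↥((κ.restrict K hK).layer n) := NumberField.of_module_finite K _
    obtain ⟨e⟩ := nonempty_ringEquiv_layer_restrict_fieldRange_sup_layer κ K hK (j'.comp (IsScalarTower.toAlgHom ℚ K K')) n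
    have hδn := hδ (κ.restrict K hK) hcycK n
    have e1 := @narrowClassNumber_eq_of_ringEquiv _ _ _ _ instL instA e
    have e2 := @classNumber_eq_of_ringEquiv _ _ _ instL _ instA e
    change padicValNat 2 (narrowClassNumber ↥((κ.restrict K hK).layer n)) ≤
      padicValNat 2 (classNumber ↥((κ.restrict K hK).layer n)) + D at hδn
    rw [e1, e2] at hδn
    exact hδn
  exact (classicalMuVanishes_iff_of_isCyclotomic _ _ (isCyclotomic_restrict κ hκ _ hK') hκF).mp h2

/-- **The case `D = 0`: narrow and wide `2`-class numbers agree along the tower of `K`** (e.g. `K` totally real with one prime above `2` and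
odd narrow class number — every layer then has odd narrow class number — or the units of every `K_n` take every signature).
[cite: Iwasawa1973MuInvariants, Thm. 2 and Thm. 3, §4] [cite: Washington1997, §13.3 Prop. 13.23] [cite: FrohlichTaylor1990, Ch. V §1 (1.12)] -/
theorem classicalMu_of_sq_eq_of_odd_finrank_of_narrowClassNumber_eq
    (K K' : Type) [Field K] [NumberField K] [Field K'] [NumberField K'] [Algebra K K'] [IsTotallyComplex K']
    (hodd : Odd (Module.finrank ℚ K))
    {x : 𝓞 K'} {m : 𝓞 K} (hm : m ≠ 0) (hx : x ^ 2 = algebraMap (𝓞 K) (𝓞 K') m) (hgen : Algebra.adjoin K {(x : K')} = ⊤)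
    (hμ : ∀ κP : ZpExtension K 2, κP.IsCyclotomic → ClassicalMuVanishes κP)
    (hnw : ∀ κP : ZpExtension K 2, κP.IsCyclotomic → ∀ n : ℕ,
      haveI : FiniteDimensional K ↥(κP.layer n) := κP.finiteDimensional_layer_holds n
      haveI : NumberField ↥(κP.layer n) := NumberField.of_module_finite K _
      padicValNat 2 (narrowClassNumber ↥(κP.layer n)) = padicValNat 2 (classNumber ↥(κP.layer n))) :
    ∀ κF : ZpExtension K' 2, κF.IsCyclotomic → ClassicalMuVanishes κF :=
  classicalMu_of_sq_eq_of_odd_finrank_of_narrowDefect_le K K' hodd hm hx hgen hμ 0 (fun κP hκP n ↦ by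
    have h := hnw κP hκP n
    omega)

end Literature.NumberTheory.IwasawaTheory

end
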